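import Summits.NavierStokesRegularity.NavierStokesRegularity.Theorems.FilamentSkeletonRssSkeletonJ1RLiaSelfEnvelope
import Summits.NavierStokesRegularity.NavierStokesRegularity.Theorems.FilamentSkeletonRssSkeletonJ1RLiaRefEnvelope

/-!
# Route `FilamentSkeletonRss` · crux `SkeletonJ1R` (stmt-NavierStokesRegularity-23610) · stub F2 `LiaDefectL` — SELF-STRAND BRICK (S4):
# the local-induction estimate FOR THE LIA REFERENCE (brick S3 fed with the reference envelopes of brick E2)

Lead `ns-fsr-lead-23610` (g2), line `streamline_kantorovich_R` (skeleton of record v5).  Helper file `--supports stmt-NavierStokesRegularity-23610`;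
route-independent (no `Theses` import).

`IsLiaReference.selfStrand_sub_lia_le`: for THE local-induction reference `x` (datum in general position and separated, unit directions; global tilt
`≤ θ₁` inside the partner-distance budget — delivered by `IsLiaReference.tilt_le` under the landed rate hypotheses), every filament `j`, every
parameter `τ`, every kernel core `e > 0` and window radii `0 < R ≤ L`, the Biot–Savart self strand
`S_j(τ) = ∫ K_e(‖x_j τ − x_j σ‖) • x_j′σ × (x_j τ − x_j σ) dσ` is integrable and
`‖S_j(τ) − Λ_e(R) • x_j′τ × x_j″τ‖ ≤ 16R(H + κ_R²) + 8(κ_R R)²κ_R Λ_e(R) + 16κ₀ log(L/R) + 16(ε₁ + κ_L²)(L − R) + 16π(θ + θ²)/L`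
for ANY upper bounds `ε₀, ε₁, κ_R, κ₀, κ_L, H, θ` of the reference's explicit envelope data: `ε₀ ≥ |β⁻¹|(B_d + Q‖w_j‖)`, `ε₁ ≥ |β⁻¹|Q`
(`Q = ½ + |α|`, `B_d = Σ_{k≠j}|Γγ_k/4π|·2/d`, `d = (ρ/2)√Γ`), `κ_R ≥ ε₀ + ε₁(|τ|+R)` with `κ_R R ≤ 1`, `κ₀ ≥ ε₀ + ε₁|τ|`, `κ_L ≥ ε₀ + ε₁(|τ|+L)`,
`2θ₁ ≤ θ ≤ 1`, and `H ≥ |β⁻¹|(C·2B_x/ℓ²·W + κ_R W + L_W)` (`B_x = ‖w_j‖ + |τ| + R`, `W = B_d + Q B_x`, `L_W = Σ|Γγ_k/4π|·6/d² + Q`, `C` a Lipschitz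
constant of `Real.smoothTransition`).  With `R ≍ √Γ`, `L ≍ ℓ` every term is `O((√Γ + |τ|)/√log Γ)` after the factor `Γγ_j/4π` (RATE B); that
Γ-bookkeeping is the next brick.
HONEST FRAMING: MODEL rung, ∃-side helper lemmas toward stub F2 of a HYPOTHETICAL filament-type blow-up skeleton; F2 and the crux 23610 stay OPEN;
nothing here bears on Navier–Stokes regularity, which is NOT proved. [folklore]
-/

-- `dupNamespace` off: the module name repeats `NavierStokesRegularity` by the tree's `Summits/<S>/<S>/Theorems` layout (same as every sibling file).
set_option linter.dupNamespace false

noncomputable section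

namespace Summit.NavierStokesRegularity.NavierStokesRegularity.Theorems.SkeletonJ1RFrame

open Set Function Filter Real Topology MeasureTheory
open Literature.Analysis.FluidPDE
open scoped InnerProductSpace BigOperators

variable {N : ℕ} {Γ Rb ρ θd : ℝ} {p t : Fin N → EuclideanSpace ℝ (Fin 3)} {γ : Fin N → ℝ} {α : ℝ} {s₀ : Fin N → ℝ}
  {x : Fin N → ℝ → EuclideanSpace ℝ (Fin 3)}

/-- **The local-induction estimate for the LIA reference** (see the module docstring). [folklore] -/
theorem IsLiaReference.selfStrand_sub_lia_le (hx : IsLiaReference Γ Rb p t γ α s₀ x) (ht : ∀ k, ‖t k‖ = 1) (hθd : 0 < θd)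
    (hθd1 : θd ≤ 1) (hgp : ∀ j k, j ≠ k → |inner ℝ (t j) (t k)| ≤ 1 - θd) (hρ : 0 < ρ)
    (hsep : ∀ j k, j ≠ k → ∀ a b : ℝ, ρ ≤ ‖(p j + a • t j) - (p k + b • t k)‖) (hΓ : 0 < Γ)
    (hℓ : Rb * Real.sqrt (Γ * Real.log Γ) ≠ 0) (j : Fin N) {θ₁ : ℝ} (hθ₁0 : 0 ≤ θ₁)
    (hθ₁A : ∀ k, k ≠ j → θ₁ ≤ min (Real.sqrt θd / 4) (θd * ρ / (16 * (‖(p j + s₀ j • t j) - (p k + s₀ k • t k)‖ + ρ))))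
    (htilt : ∀ σ, ‖deriv (x j) σ - t j‖ ≤ θ₁) {C : ℝ} (hC0 : 0 ≤ C)
    (hC : ∀ a b : ℝ, |Real.smoothTransition a - Real.smoothTransition b| ≤ C * |a - b|) {e : ℝ} (he : 0 < e)
    {τ R L ε₀ ε₁ H θ κR κ0 κL : ℝ} (hR : 0 < R) (hRL : R ≤ L)
    (hε₀ : |(liaCoeff Γ γ j)⁻¹| * ((∑ k ∈ Finset.univ.erase j, |Γ*γ k/(4*Real.pi)| * (2 / (ρ / 2 * Real.sqrt Γ))) +
      (1/2 + |α|) * ‖waistPt Γ p t s₀ j‖) ≤ ε₀)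
    (hε₁ : |(liaCoeff Γ γ j)⁻¹| * (1/2 + |α|) ≤ ε₁) (hθ : 2 * θ₁ ≤ θ) (hθ1 : θ ≤ 1)
    (hκR : ε₀ + ε₁ * (|τ| + R) ≤ κR) (hκ0 : ε₀ + ε₁ * |τ| ≤ κ0) (hκL : ε₀ + ε₁ * (|τ| + L) ≤ κL) (hsmall : κR * R ≤ 1)
    (hH : |(liaCoeff Γ γ j)⁻¹| *
      (C * (2 * (‖waistPt Γ p t s₀ j‖ + |τ| + R)) / (Rb * Real.sqrt (Γ * Real.log Γ)) ^ 2 *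
          ((∑ k ∈ Finset.univ.erase j, |Γ*γ k/(4*Real.pi)| * (2 / (ρ / 2 * Real.sqrt Γ))) +
            (1/2 + |α|) * (‖waistPt Γ p t s₀ j‖ + |τ| + R)) +
        κR * ((∑ k ∈ Finset.univ.erase j, |Γ*γ k/(4*Real.pi)| * (2 / (ρ / 2 * Real.sqrt Γ))) +
            (1/2 + |α|) * (‖waistPt Γ p t s₀ j‖ + |τ| + R)) +
        ((∑ k ∈ Finset.univ.erase j, |Γ*γ k/(4*Real.pi)| * (6 / (ρ / 2 * Real.sqrt Γ) ^ 2)) + (1/2 + |α|))) ≤ H) :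
    Integrable (fun σ : ℝ => ((‖x j τ - x j σ‖ ^ 2 + e ^ 2) ^ (3 / 2 : ℝ))⁻¹ • cross (deriv (x j) σ) (x j τ - x j σ)) ∧
      ‖(∫ σ, ((‖x j τ - x j σ‖ ^ 2 + e ^ 2) ^ (3 / 2 : ℝ))⁻¹ • cross (deriv (x j) σ) (x j τ - x j σ)) -
          (Real.arsinh (R / e) - R / Real.sqrt (R ^ 2 + e ^ 2)) • cross (deriv (x j) τ) (deriv (deriv (x j)) τ)‖ ≤
        16 * R * (H + κR ^ 2) + 8 * (κR * R) ^ 2 * κR * (Real.arsinh (R / e) - R / Real.sqrt (R ^ 2 + e ^ 2)) +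
          16 * κ0 * Real.log (L / R) + 16 * (ε₁ + κL ^ 2) * (L - R) + 16 * Real.pi * (θ + θ ^ 2) / L := by
  obtain ⟨hC2, hunit, h0, h0', hode⟩ := hx j
  set d : ℝ := ρ / 2 * Real.sqrt Γ with hd
  have hd0 : 0 < d := by have := Real.sqrt_pos.2 hΓ; positivity
  set β := liaCoeff Γ γ j with hβ
  set Q : ℝ := 1/2 + |α| with hQ
  set Bd : ℝ := ∑ k ∈ Finset.univ.erase j, |Γ*γ k/(4*Real.pi)| * (2 / d) with hBd
  set w := waistPt Γ p t s₀ j with hw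
  have hQ0 : 0 ≤ Q := by positivity
  have hBd0 : 0 ≤ Bd := Finset.sum_nonneg fun k _ => by positivity
  -- partner distance everywhere
  have hfar : ∀ σ, ∀ k, k ≠ j → d ^ 2 ≤ ‖x j σ - waistPt Γ p t s₀ k‖ ^ 2 - (inner ℝ (x j σ - waistPt Γ p t s₀ k) (t k)) ^ 2 :=
    fun σ => hx.dist_partner_ge_of_tilt ht hθd hθd1 hgp hρ hsep j hθ₁0 hθ₁A htilt σ
  -- the linear envelope
  have hε₀0 : 0 ≤ ε₀ := le_trans (by positivity) hε₀
  have hε₁0 : 0 ≤ ε₁ := le_trans (by positivity) hε₁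
  have henv : ∀ σ, ‖deriv (deriv (x j)) σ‖ ≤ ε₀ + ε₁ * |σ| := by
    intro σ
    have h := hx.curvature_envelope ht j σ hd0 (hfar σ)
    have hsplit : |β⁻¹| * (Bd + Q * (‖w‖ + |σ|)) = |β⁻¹| * (Bd + Q * ‖w‖) + (|β⁻¹| * Q) * |σ| := by ring
    calc ‖deriv (deriv (x j)) σ‖ ≤ |β⁻¹| * (Bd + Q * (‖w‖ + |σ|)) := h
      _ = |β⁻¹| * (Bd + Q * ‖w‖) + (|β⁻¹| * Q) * |σ| := hsplit
      _ ≤ ε₀ + ε₁ * |σ| := add_le_add hε₀ (mul_le_mul_of_nonneg_right hε₁ (abs_nonneg σ))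
  -- oscillation
  have hosc : ∀ u v, ‖deriv (x j) u - deriv (x j) v‖ ≤ θ := by
    intro u v
    calc ‖deriv (x j) u - deriv (x j) v‖ = ‖(deriv (x j) u - t j) - (deriv (x j) v - t j)‖ := by congr 1; abel
      _ ≤ ‖deriv (x j) u - t j‖ + ‖deriv (x j) v - t j‖ := norm_sub_le _ _
      _ ≤ θ₁ + θ₁ := add_le_add (htilt u) (htilt v)
      _ ≤ θ := by linarith
  -- nonnegativity of κR and of the H-expression
  have hκR0 : 0 ≤ κR := le_trans (by positivity) hκR
  set Bx : ℝ := ‖w‖ + |τ| + R with hBx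
  have hBx0 : 0 ≤ Bx := by positivity
  have hH0 : 0 ≤ H := by
    refine le_trans ?_ hH
    have : 0 ≤ C * (2 * Bx) / (Rb * Real.sqrt (Γ * Real.log Γ)) ^ 2 * (Bd + Q * Bx) := by positivity
    positivity
  -- the curvature is Lipschitz on the window
  have hHw : ∀ q, |q - τ| ≤ R → ‖deriv (deriv (x j)) q - deriv (deriv (x j)) τ‖ ≤ H * |q - τ| := by
    intro q hq
    have hxq : ‖x j q‖ ≤ Bx := by
      have h1 := hx.norm_le j q
      have h2 : |q| ≤ |τ| + R := by
        calc |q| = |τ + (q - τ)| := by ring_nf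
          _ ≤ |τ| + |q - τ| := abs_add_le _ _
          _ ≤ |τ| + R := by linarith
      rw [hBx]; linarith
    have hxτ : ‖x j τ‖ ≤ Bx := by have h1 := hx.norm_le j τ; rw [hBx]; linarith
    have hκ : ∀ r ∈ uIcc τ q, ‖deriv (deriv (x j)) r‖ ≤ κR := by
      intro r hr
      have h1 := henv r
      have h2 := (SkeletonJ1RLiaSelf.abs_le_of_mem_uIcc hr).2
      have h3 : |r| ≤ |τ| + R := h2.trans (by linarith)
      nlinarith [mul_le_mul_of_nonneg_left h3 hε₁0]
    have h := hx.curvature_sub_le ht j hC0 hC hℓ hd0 hBx0 (hfar q) (hfar τ) hxq hxτ hκ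
    exact h.trans (mul_le_mul_of_nonneg_right hH (abs_nonneg _))
  exact SkeletonJ1RLiaSelf.selfStrand_sub_lia_le hC2 hunit he hR hRL hε₀0 hε₁0 henv hH0 hHw hθ1 hosc hκR hκ0 hκL hsmall

end Summit.NavierStokesRegularity.NavierStokesRegularity.Theorems.SkeletonJ1RFrame

end
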